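import Summits.AtomisticToContinuum.Crystallization.Theorems.ChargedEnergyGapExposureDial
import Summits.AtomisticToContinuum.Crystallization.Theorems.ChargedEnergyGapGrossCrowding
import Summits.AtomisticToContinuum.Crystallization.Theorems.LayeredLawsSelectHcp.Negative.Threshold
import HarnessLib

/-!
# `ChargedEnergyGap` — the COOL GUARD: the crux is EXACTLY the pricing of COOL, HARD-CORE periodic configurations
# (cell `decomp-a2c`, lens 3 «one certified translation + split beneath», generation 48, node «CoolGuard», part K-A)

Decomposition node on `Summit.AtomisticToContinuum.Crystallization.Theses.PricedLinkCensus.ChargedEnergyGap`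
(`stmt-AtomisticToContinuum-14231`).

## Why (generation 48 self-audit of the lineage's localised pieces)

Every piece of the lineage's record cone is a pricing statement quantified over ALL periodic configurations `Q` —
crowded ones included.  COUNT pricings (`GrossChargeGap`, `ImprovablePricing`, …) are robust to crowding (crowding only
adds excess), but the LOCALISED pieces of generation 47 (`CoreBallPricingOn`, `FarFloor`: weighted SIGNED site excesses,
debits weighted at the debited site) are REFUTED AS TYPED by a «rim flower»: `M` mutually crowded particles at distance
`1` from a site `z` where an account's weight is positive, themselves sitting where it vanishes, give that account
`−M/24 · (weight of z)` (`½·M·V(1)`, `V(1) = −1/12`) with no debit and no bound on `M` (memo `g48/MEMO.md` §1).  The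
repair begins with a GUARD that is provably free: the crux loses nothing if every pricing is demanded only of
configurations that are

* **`ε`-cool** — no motif site is an `ε`-rattler (`…ExposureDial.Rattler`: `e* + ε ≤ 2·siteEnergy`), and
* **`s`-separated** — points pairwise `≥ s` apart,

for any `0 < ε` with `e* + ε ≤ 0` and any `s ≤ 1/3` (record `(ε, s) = (1/10, 1/3)`, the exposure dial's `ε`).

## TRANSLATION (the one allowed EQUIV — PROVED here, `chargedEnergyGap_iff_guardedPricing`)

`ChargedEnergyGap ↔ ∃ κ > 0, ∀ Q, Guard ε s Q → κ·#charged motif sites ≤ #F·(e(Q) − e*)`.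

`⇒` is the tree's periodic form (`chargedEnergyGap_iff_periodicPricing`).  `⇐`: (i) the far periodisation of a finite
injective configuration that is cool and separated in the FINITE sense is guarded (`guard_periodiseFar`: lattice images
only lower site energies, `tsum_le_siteEnergy`, and are `≥ 2` away), so guarded periodic pricing prices every cool
separated finite configuration (`coolSepPricing_of_guardedPricing`); (ii) HOT SITES DELETE THEMSELVES
(`noBoundary_of_coolSepPricing`, the induction of `BarlowRelativePricingRegularise.stub_regularise` with the hot site in
place of the closest pair): a configuration that is not cool-and-separated has a site of site energy `≥ e* + ε` — a
rattler, or a particle of a closest pair at distance `< 1/3` (`ChargedEnergyGapGrossSurgery.le_siteEnergy_of_closest`: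
`≥ 1 + r⁻³ ≥ 0 ≥ e* + ε`); deleting it costs `≥ e* + ε` and recounts at most `F` charges (`ChargeRecount` = the tree's
PROVED `BarlowRelativePricingRecount.stub_chargeRecount`, `F = 812`, carried as a named hypothesis only because that
module's farm build was stale at check time — part K-A′ `…CoolGuardRecount` discharges it), absorbed by `κ ≤ ε/(F+1)`;
(iii) `chargedEnergyGap_iff_noBoundary`.  Under the guard the rattler species is EMPTY (`exposed_iff_nearHole_of_guard`).
The split beneath — the GUARDED chart dial, exact — is part K-B (`…ChargedEnergyGapCoolGuardDial`); threading the guard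
down the gross-side dial chain and re-typing the ledger under it are memo §3–§4.

All `[this work]` = cell decomp-a2c lens 3; ingredients `[folklore]` from the tree as named.
-/

noncomputable section

open scoped BigOperators
open Literature.MathematicalPhysics.StatisticalMechanics
open Literature.Geometry.DiscreteGeometry
open Summit.AtomisticToContinuum.Crystallization.Theses.PricedLinkCensus
open Summit.AtomisticToContinuum.Crystallization.Theorems.ChargedEnergyGapNegative

namespace Summit.AtomisticToContinuum.Crystallization.Theorems.ChargedEnergyGapChartDial

/-! ## §1 The guards -/

section Guards

variable {N : ℕ}

/-- Finite reading of the rattler species: site `i` of `y` is **`ε`-hot** if its (full) site energy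
`∑_{k ≠ i} V(|yᵢ − y_k|)` is `≥ e* + ε`. -/
def HotSite (ε : ℝ) (y : Fin N → E3) (i : Fin N) : Prop :=
  eStar + ε ≤ Literature.MathematicalPhysics.StatisticalMechanics.siteEnergy lennardJones y i

/-- Finite guard: **cool** (no `ε`-hot site) **and `s`-separated**. -/
def CoolSep (ε s : ℝ) (y : Fin N → E3) : Prop :=
  (∀ i, ¬ HotSite ε y i) ∧ ∀ i j : Fin N, i ≠ j → s ≤ dist (y i) (y j)

/-- Periodic guard: **no motif site is an `ε`-rattler, and the points of `Q` are pairwise `≥ s` apart**. -/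
def Guard (ε s : ℝ) (Q : PeriodicConfiguration 3) : Prop :=
  (∀ x : Q.motif, ¬ Rattler ε Q x) ∧ ∀ p ∈ Q.points, ∀ q ∈ Q.points, p ≠ q → s ≤ dist p q

/-- **Guarded periodic pricing** at rate `κ`: every GUARDED periodic configuration pays `κ` per charged motif site. -/
def GuardedPricing (ε s κ : ℝ) : Prop :=
  ∀ Q : PeriodicConfiguration 3, Guard ε s Q → κ * (motifCharged (1 / 100) Q : ℝ) ≤ excess Q

/-- **Charge recount under deletion** (NAMED TREE FACT, PROVED: this is VERBATIM the statement of
`Summit.AtomisticToContinuum.Crystallization.Theorems.BarlowRelativePricingRecount.stub_chargeRecount`, file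
`Theorems/PricedLinkCensusChargedEnergyGapChargeRecount.lean`, `F = 812`; carried as a hypothesis here only because that
module's farm build was stale when this file was checked — `…ChargedEnergyGapCoolGuardRecount.chargeRecount` discharges it):
deleting one particle raises the number of charged sites by at most an absolute constant. -/
def ChargeRecount : Prop :=
  ∃ F : ℕ, ∀ (N : ℕ) (x : Fin (N + 1) → EuclideanSpace ℝ (Fin 3)) (i₀ : Fin (N + 1)), Function.Injective x →
    Nat.card {i : Fin (N + 1) // ¬ Literature.Geometry.DiscreteGeometry.IsChargeFree (1 / 100 : ℝ) x i} ≤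
      Nat.card {i : Fin N // ¬ Literature.Geometry.DiscreteGeometry.IsChargeFree (1 / 100 : ℝ) (x ∘ Fin.succAbove i₀) i} + F

/-- Under the guard no motif site is a rattler. -/
theorem Guard.not_rattler {ε s : ℝ} {Q : PeriodicConfiguration 3} (h : Guard ε s Q) (x : Q.motif) : ¬ Rattler ε Q x :=
  h.1 x

/-- Under the guard the points are `s`-separated. -/
theorem Guard.le_dist {ε s : ℝ} {Q : PeriodicConfiguration 3} (h : Guard ε s Q) {p q : E3} (hp : p ∈ Q.points)
    (hq : q ∈ Q.points) (hpq : p ≠ q) : s ≤ dist p q :=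
  h.2 p hp q hq hpq

/-- The guard is antitone in the separation. -/
theorem Guard.anti {ε s s' : ℝ} (hs : s' ≤ s) {Q : PeriodicConfiguration 3} (h : Guard ε s Q) : Guard ε s' Q :=
  ⟨h.1, fun p hp q hq hpq => hs.trans (h.2 p hp q hq hpq)⟩

/-- ★ Under the guard the EXPOSED species of the exposure dial is the near-hole species alone: rattlers are gone. -/
theorem exposed_iff_nearHole_of_guard {ε s R : ℝ} {Q : PeriodicConfiguration 3} (h : Guard ε s Q) (x : Q.motif) :
    Exposed ε R Q x ↔ NearHole ε R Q x :=
  ⟨fun he => he.resolve_left (h.1 x), Or.inr⟩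

/-- Unguarded periodic pricing is guarded periodic pricing (any guard). -/
theorem guardedPricing_of_periodicPricing {ε s κ : ℝ} (h : PeriodicPricing (1 / 100) κ) : GuardedPricing ε s κ :=
  fun Q _ => h Q

/-- Guarded pricing is antitone in the rate. -/
theorem GuardedPricing.anti {ε s κ κ' : ℝ} (hκ : κ' ≤ κ) (h : GuardedPricing ε s κ) : GuardedPricing ε s κ' :=
  fun Q hQ => (mul_le_mul_of_nonneg_right hκ (Nat.cast_nonneg _)).trans (h Q hQ)

/-- Guarded pricing is monotone in the separation demanded (a stronger guard prices fewer configurations). -/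
theorem GuardedPricing.mono_sep {ε s s' κ : ℝ} (hs : s ≤ s') (h : GuardedPricing ε s κ) : GuardedPricing ε s' κ :=
  fun Q hQ => h Q (hQ.anti hs)

end Guards

/-! ## §2 Hot sites delete themselves: guarded finite pricing ⟹ the allowance-free gap -/

section Deletion

variable {N : ℕ}

/-- **A particle of a closest pair at distance `< 1/3` is `ε`-hot** whenever `e* + ε ≤ 1`: its site energy is `≥ 1 + r⁻³ ≥ 1`
(`ChargedEnergyGapGrossSurgery.le_siteEnergy_of_closest`). -/
theorem exists_hotSite_of_dist_lt {ε : ℝ} (hε1 : eStar + ε ≤ 1) {y : Fin N → E3} (hy : Function.Injective y)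
    {i k : Fin N} (hki : k ≠ i) (hik : dist (y i) (y k) < 1 / 3) : ∃ i₀, HotSite ε y i₀ := by
  classical
  obtain ⟨p, hp, hmin⟩ := Finset.exists_min_image Finset.univ.offDiag
    (fun p : Fin N × Fin N => dist (y p.1) (y p.2)) ⟨(i, k), by simp [hki.symm]⟩
  obtain ⟨i₀, j₀⟩ := p
  have hij₀ : i₀ ≠ j₀ := by simpa using hp
  have hsep : ∀ a b : Fin N, a ≠ b → dist (y i₀) (y j₀) ≤ dist (y a) (y b) :=
    fun a b hab => hmin (a, b) (by simp [hab])
  have hr3 : dist (y i₀) (y j₀) < 1 / 3 := (hsep i k hki.symm).trans_lt hik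
  have hu := ChargedEnergyGapGrossSurgery.le_siteEnergy_of_closest hy hij₀ hsep hr3
  refine ⟨i₀, ?_⟩
  unfold HotSite
  have h3 : (0 : ℝ) ≤ (dist (y i₀) (y j₀))⁻¹ ^ 3 := by positivity
  linarith

/-- A configuration that is not cool-and-separated (`s ≤ 1/3`, `e* + ε ≤ 1`) has an `ε`-hot site: a hot site directly, or a
particle of a closest pair at distance `< s ≤ 1/3`. -/
theorem exists_hotSite_of_not_coolSep {ε s : ℝ} (hs : s ≤ 1 / 3) (hε1 : eStar + ε ≤ 1) {y : Fin N → E3}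
    (hy : Function.Injective y) (h : ¬ CoolSep ε s y) : ∃ i₀, HotSite ε y i₀ := by
  by_contra hno
  push Not at hno
  apply h
  refine ⟨hno, fun i j hij => ?_⟩
  by_contra hlt
  push Not at hlt
  obtain ⟨i₀, hi₀⟩ := exists_hotSite_of_dist_lt hε1 hy (Ne.symm hij) (lt_of_lt_of_le hlt hs)
  exact hno i₀ hi₀

/-- Rate conversion: a pricing at rate `κ₁` is a pricing at any rate `κ ≤ κ₁`. -/
theorem gap_of_gap_of_le {κ κ₁ e E : ℝ} {n D : ℕ} (hκ : κ ≤ κ₁) (h : (n : ℝ) * e + κ₁ * (D : ℝ) ≤ E) :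
    (n : ℝ) * e + κ * (D : ℝ) ≤ E :=
  le_trans (by nlinarith [Nat.cast_nonneg (α := ℝ) D]) h

/-- ★ **HOT SITES DELETE THEMSELVES.**  If `κ₁ > 0` prices charge on every injective configuration that is `ε`-cool and
`s`-separated (`0 < ε`, `e* + ε ≤ 0`, `s ≤ 1/3`), then `κ = min κ₁ (ε/(F+1))` (`F` the recount constant of
`ChargeRecount`) prices it on EVERY injective configuration: `NoBoundary (1/100) κ`.  Induction on `N`, deleting a
hot site `i₀`: `E(y) = E(y ∘ i₀.succAbove) + (≥ e* + ε)`, `#ch(y) ≤ #ch(y ∘ i₀.succAbove) + F`, `κ·F ≤ ε`. -/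
theorem noBoundary_of_coolSepPricing (hF : ChargeRecount) {ε s κ₁ : ℝ} (hε : 0 < ε) (hε0 : eStar + ε ≤ 0)
    (hs : s ≤ 1 / 3) (hκ₁ : 0 < κ₁)
    (h : ∀ (N : ℕ) (y : Fin N → E3), Function.Injective y → CoolSep ε s y →
      (N : ℝ) * eStar + κ₁ * (charged (1 / 100) y : ℝ) ≤ interactionEnergy lennardJones y) :
    ∃ κ : ℝ, 0 < κ ∧ NoBoundary (1 / 100) κ := by
  obtain ⟨F, hF⟩ := hF
  have hεB : eStar + ε ≤ 1 := hε0.trans (by norm_num)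
  set κ := min κ₁ (ε / ((F : ℝ) + 1)) with hκdef
  have hκpos : 0 < κ := lt_min hκ₁ (by positivity)
  have hκle : κ ≤ κ₁ := min_le_left _ _
  have hκF : κ * (F : ℝ) ≤ ε := by
    calc κ * (F : ℝ) ≤ ε / ((F : ℝ) + 1) * ((F : ℝ) + 1) :=
          mul_le_mul (min_le_right _ _) (by linarith) (Nat.cast_nonneg _) (by positivity)
      _ = ε := div_mul_cancel₀ _ (by positivity)
  refine ⟨κ, hκpos, ?_⟩
  intro N
  induction N with
  | zero =>
    intro y hy
    exact gap_of_gap_of_le hκle (h 0 y hy ⟨fun i => i.elim0, fun i => i.elim0⟩)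
  | succ n ih =>
    intro y hy
    by_cases hc : CoolSep ε s y
    · exact gap_of_gap_of_le hκle (h (n + 1) y hy hc)
    obtain ⟨i₀, hi₀⟩ := exists_hotSite_of_not_coolSep hs hεB hy hc
    have hy' : Function.Injective (y ∘ i₀.succAbove) := hy.comp Fin.succAbove_right_injective
    have hE : interactionEnergy lennardJones y =
        interactionEnergy lennardJones (y ∘ i₀.succAbove) +
          Literature.MathematicalPhysics.StatisticalMechanics.siteEnergy lennardJones y i₀ :=
      interactionEnergy_eq_succAbove_add_siteEnergy lennardJones lennardJones_zero y i₀
    have hih := ih (y ∘ i₀.succAbove) hy'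
    have hDR : (charged (1 / 100) y : ℝ) ≤ (charged (1 / 100) (y ∘ i₀.succAbove) : ℝ) + F := by
      have := hF n y i₀ hy
      unfold charged
      exact_mod_cast this
    have hhot : eStar + ε ≤ Literature.MathematicalPhysics.StatisticalMechanics.siteEnergy lennardJones y i₀ := hi₀
    rw [Nat.cast_succ, hE]
    have hκD : κ * (charged (1 / 100) y : ℝ) ≤ κ * (charged (1 / 100) (y ∘ i₀.succAbove) : ℝ) + κ * F := by
      nlinarith [hκpos.le]
    linarith

end Deletion

/-! ## §3 Guarded periodic pricing prices every cool separated finite configuration -/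

section Periodic

variable {N : ℕ}

/-- A single point has site energy `0`. -/
theorem siteEnergy_fin_one (y : Fin 1 → E3) (i : Fin 1) :
    Literature.MathematicalPhysics.StatisticalMechanics.siteEnergy lennardJones y i = 0 := by
  unfold Literature.MathematicalPhysics.StatisticalMechanics.siteEnergy
  have : Finset.univ.erase i = (∅ : Finset (Fin 1)) := by
    ext j
    simp only [Finset.mem_erase, Finset.mem_univ, and_true, Finset.notMem_empty, iff_false, not_not]
    exact Subsingleton.elim j i
  rw [this, Finset.sum_empty]

/-- Twice the periodic site energy of a motif point of the far periodisation is the full lattice sum at that point, which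
is at most the finite site energy (`tsum_le_siteEnergy`: images are `≥ 2` away and only lower it). -/
theorem two_mul_siteEnergy_periodiseFar_le {y : Fin N → E3} (hy : Function.Injective y) (hN : 0 < N) (i : Fin N) :
    2 * siteEnergy (periodiseFar y hN) (y i) ≤
      Literature.MathematicalPhysics.StatisticalMechanics.siteEnergy lennardJones y i := by
  have h := tsum_le_siteEnergy hy (spacingUnit y) (period_le_spacing y) hN i
  have h2 : 2 * siteEnergy (periodiseFar y hN) (y i) =
      ∑' z : {z : E3 // z ∈ (periodiseFar y hN).points ∧ z ≠ y i}, lennardJones (dist (y i) z.1) := by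
    unfold siteEnergy
    rw [← mul_assoc]
    norm_num
  rw [h2]
  exact h

/-- ★ **The far periodisation of a cool, `s`-separated finite configuration is guarded** (`s ≤ 2`): motif points keep (at most)
their finite site energies, and two distinct points `yᵢ + g`, `yⱼ + g'` are `dist yᵢ' yⱼ ≥ s` apart when `yᵢ + (g − g')`
is a motif point `yᵢ'`, and `≥ 2` apart otherwise (`two_le_dist_of_mem_points`). -/
theorem guard_periodiseFar {ε s : ℝ} (hs2 : s ≤ 2) {y : Fin N → E3} (hy : Function.Injective y) (hN : 0 < N)
    (hc : CoolSep ε s y) : Guard ε s (periodiseFar y hN) := by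
  refine ⟨fun x => ?_, ?_⟩
  · -- cool
    obtain ⟨v, hv⟩ := x
    have hv' := hv
    rw [motif_periodiseFar] at hv'
    obtain ⟨i, -, rfl⟩ := Finset.mem_image.1 hv'
    intro hr
    have h1 := two_mul_siteEnergy_periodiseFar_le hy hN i
    have h2 : ¬ HotSite ε y i := hc.1 i
    unfold HotSite at h2
    unfold Rattler at hr
    push Not at h2
    exact absurd (hr.trans h1) (not_le.2 h2)
  · -- separated
    rintro p ⟨a, ha, g, hg, rfl⟩ q ⟨b, hb, g', hg', rfl⟩ hne
    rw [motif_periodiseFar] at ha hb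
    obtain ⟨i, -, rfl⟩ := Finset.mem_image.1 ha
    obtain ⟨j, -, rfl⟩ := Finset.mem_image.1 hb
    have hmem : y i + (g - g') ∈ (periodiseFar y hN).points :=
      ⟨y i, mem_motif_periodiseFar y hN i, g - g', (periodiseFar y hN).lattice.sub_mem hg hg', rfl⟩
    have hdist : dist (y i + g) (y j + g') = dist (y j) (y i + (g - g')) := by
      rw [dist_comm, dist_eq_norm, dist_eq_norm]
      congr 1
      abel
    rw [hdist]
    by_cases hk : ∃ k, y i + (g - g') = y k
    · obtain ⟨k, hk⟩ := hk
      rw [hk]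
      have hjk : j ≠ k := by
        rintro rfl
        apply hne
        have : y i + g = y j + g' := by
          have := hk
          rw [← sub_eq_zero] at this ⊢
          rw [← this]
          abel
        exact this
      exact hc.2 j k hjk
    · push Not at hk
      have h2 := two_le_dist_of_mem_points y (spacingUnit y) (period_le_spacing y) hN j hmem hk
      exact hs2.trans h2

/-- ★ **Guarded periodic pricing prices every cool separated finite configuration** (`e* + ε ≤ 0`, `s ≤ 2`): `N = 0` is
trivial, a single point is hot (site energy `0 ≥ e* + ε`), and for `N ≥ 2` the far periodisation is guarded
(`guard_periodiseFar`), has the charged sites of `y` as charged motif sites (`motifCharged_periodiseFar`) and energy per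
particle `≤ E(y)/N` (`energyPerParticle_periodise_le`). -/
theorem coolSepPricing_of_guardedPricing {ε s κ : ℝ} (hε0 : eStar + ε ≤ 0) (hs2 : s ≤ 2) (h : GuardedPricing ε s κ) :
    ∀ (N : ℕ) (y : Fin N → E3), Function.Injective y → CoolSep ε s y →
      (N : ℝ) * eStar + κ * (charged (1 / 100) y : ℝ) ≤ interactionEnergy lennardJones y := by
  intro N y hy hc
  rcases Nat.lt_or_ge N 2 with hN | hN
  · interval_cases N
    · rw [charged_zero, interactionEnergy_of_subsingleton]
      simp
    · exact absurd (hε0.trans_eq (siteEnergy_fin_one y 0).symm) (hc.1 0)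
  · have hN0 : 0 < N := by omega
    have hN2 : ∀ i : Fin N, ∃ j, j ≠ i := exists_ne_of_two_le hN
    have hp := h (periodiseFar y hN0) (guard_periodiseFar hs2 hy hN0 hc)
    rw [motifCharged_periodiseFar hy hN0 (by norm_num) hN2] at hp
    have hcard : (((periodiseFar y hN0).motif.card : ℕ) : ℝ) = N := by
      rw [motif_periodiseFar, Finset.card_image_of_injective _ hy, Finset.card_univ, Fintype.card_fin]
    unfold excess at hp
    rw [hcard] at hp
    have hNr : (0 : ℝ) < N := by exact_mod_cast hN0
    have he := energyPerParticle_periodise_le hy (spacingUnit y) (period_le_spacing y) hN0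
    rw [le_div_iff₀ hNr, mul_comm] at he
    have he' : (N : ℝ) * (periodiseFar y hN0).energyPerParticle lennardJones ≤ interactionEnergy lennardJones y := he
    nlinarith

/-! ## §4 ★★ THE TRANSLATION: the crux is EXACTLY the guarded periodic pricing -/

/-- ★★ **`ChargedEnergyGap ↔ ∃ κ > 0, GuardedPricing ε s κ`** for every `0 < ε` with `e* + ε ≤ 0` and every `s ≤ 1/3`
(given the tree fact `ChargeRecount`): pricing charge on `ε`-COOL, `s`-SEPARATED periodic configurations is the whole crux. -/
theorem chargedEnergyGap_iff_guardedPricing (hF : ChargeRecount) {ε s : ℝ} (hε : 0 < ε) (hε0 : eStar + ε ≤ 0)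
    (hs : s ≤ 1 / 3) : ChargedEnergyGap ↔ ∃ κ : ℝ, 0 < κ ∧ GuardedPricing ε s κ := by
  constructor
  · intro hC
    obtain ⟨κ, hκ, hp⟩ := chargedEnergyGap_iff_periodicPricing.1 hC
    exact ⟨κ, hκ, guardedPricing_of_periodicPricing hp⟩
  · rintro ⟨κ₁, hκ₁, h⟩
    obtain ⟨κ, hκ, hNB⟩ := noBoundary_of_coolSepPricing hF hε hε0 hs hκ₁
      (coolSepPricing_of_guardedPricing hε0 (hs.trans (by norm_num)) h)
    exact chargedEnergyGap_iff_noBoundary.2 ⟨κ, hκ, hNB⟩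

/-- `e* + 1/10 ≤ 0` (tree: `e* ≤ −1/2`, `LayeredLawsSelectHcp.Negative.Threshold.eStar_le_neg_half`, fcc at unit spacing). -/
theorem eStar_add_tenth_nonpos : eStar + 1 / 10 ≤ 0 := by
  linarith [LayeredLawsSelectHcp.Negative.Threshold.eStar_le_neg_half]

/-- ★★ **RECORD** `(ε, s) = (1/10, 1/3)` (the exposure dial's `ε`): `ChargedEnergyGap ↔ ∃ κ > 0, GuardedPricing (1/10) (1/3) κ`
(given `ChargeRecount`; unconditional form `…CoolGuardRecount.chargedEnergyGap_iff_guardedPricing_record'`). -/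
theorem chargedEnergyGap_iff_guardedPricing_record (hF : ChargeRecount) :
    ChargedEnergyGap ↔ ∃ κ : ℝ, 0 < κ ∧ GuardedPricing (1 / 10) (1 / 3) κ :=
  chargedEnergyGap_iff_guardedPricing hF (by norm_num) eStar_add_tenth_nonpos le_rfl

end Periodic

end Summit.AtomisticToContinuum.Crystallization.Theorems.ChargedEnergyGapChartDial

end
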